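import Summits.CriticalPhenomena.PercolationContinuityZ3.Theorems.PercNearOneGluingNoHeavyLowerTailSahiTriplewiseGeneratingFunction
import Mathlib.Tactic.Linarith
import HarnessLib

/-!
# `NoHeavyLowerTail` (stmt-CriticalPhenomena-4575) — QUANTITATIVE Theorem F: `E_m ≥ (m−2)!·Cov` of some pair, for triplewise meet-contained families

Support file, seat `prim-l12-p5` (gen 4), `--supports stmt-CriticalPhenomena-4575`.  No definitions, no named facts, no sorries.
Uses `…SahiDefectExpansion` (Theorem E, quantitative form `sahiE_cons_ge_of_absorbs_top`), `…SahiHereditaryMeetAbsorption` (`exists_absorber_of_cardwise`),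
`…SahiTriplewiseGeneratingFunction` (`sahiE_comp_nonneg_of_triplewise`, `absorbs_three_of_triplewise`, `triplewise_of_absorbs_three`).

**`exists_pair_factorial_mul_cov_le_sahiE_of_triplewise`.**  FKG probability weight on a finite distributive lattice; `g_0,…,g_{m+1}` monotone
indicators such that among any three one absorbs the product of the other two.  Then there are slots `a ≠ b` with

  `E_{m+2}(g) ≥ m!·Cov(g_a, g_b)`   (`= m!·(E[g_a g_b] − E[g_a]E[g_b]) ≥ 0`).

So on the triplewise class Sahi's functional is not merely nonnegative: it dominates a factorial multiple of a pair covariance.  The constant is SHARP —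
with `m` constant slots `E_{m+2}(1,…,1,g_a,g_b) = m!·Cov(g_a,g_b)` (Sahi's branching).  Proof: peel absorbers; at each step Theorem E gives
`E_{n+3}(d, h) ≥ (n + 2 − E d)·E_{n+2}(h) ≥ (n + 1)·E_{n+2}(h)` (`E d ≤ 1`, `E_{n+2}(h) ≥ 0` by Theorem F), and the pair surviving the peeling carries
the covariance (FKG at the bottom).
-/

namespace Summit.CriticalPhenomena.PercolationContinuityZ3.Theorems

namespace SahiHereditaryMeetAbsorption

open Finset Function Literature.Combinatorics.Sahi2008 SahiMomentExpansion SahiDefectExpansion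
open scoped Nat

variable {α : Type*} [Fintype α]

/-! ### Quantitative Theorem F: `E_m ≥ (m−2)!·Cov` of some pair -/

section Quantitative

variable [DistribLattice α]

/-- **Quantitative form of Theorem F.**  FKG probability weight; `g_0,…,g_{m−1}` (`m ≥ 2`) monotone indicators, triplewise meet-contained.  Then for
SOME pair of slots `a ≠ b`:  `E_m(g) ≥ (m−2)!·Cov(g_a, g_b)` (`≥ 0` by FKG).  Sharp: constant slots give equality (`E_m(1,…,1,g_a,g_b) = (m−2)!·Cov`,
branching).  Proof: peel absorbers; at each step Theorem E gives `E_{n+2}(d,h) ≥ (n + 1 − E d)·E_{n+1}(h) ≥ n·E_{n+1}(h)`. [this file] -/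
theorem exists_pair_factorial_mul_cov_le_sahiE_of_triplewise {μ : α → ℝ} (hμ : IsFKGMeasure μ) :
    ∀ (m : ℕ) (g : Fin (m + 2) → α → ℝ), (∀ i a, g i a = 0 ∨ g i a = 1) → (∀ i, Monotone (g i)) →
      (∀ S : Finset (Fin (m + 2)), S.card = 3 → ∃ p ∈ S, ∀ x, (1 - g p x) * ∏ i ∈ S.erase p, g i x = 0) →
      ∃ a b : Fin (m + 2), a ≠ b ∧ (m ! : ℝ) * (ex μ (g a * g b) - ex μ (g a) * ex μ (g b)) ≤ sahiE μ (m + 2) g := by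
  intro m
  induction m with
  | zero =>
    intro g _ _ _
    refine ⟨0, 1, by decide, ?_⟩
    rw [sahiE_two_apply, Nat.factorial_zero, Nat.cast_one, one_mul]
  | succ n ih =>
    intro g h01 hmono htri
    have hg0 : ∀ i x, 0 ≤ g i x := fun i x => by rcases h01 i x with e | e <;> simp [e]
    have hg1 : ∀ i x, g i x ≤ 1 := fun i x => by rcases h01 i x with e | e <;> simp [e]
    -- an absorber `p` of the whole family, moved to the head
    obtain ⟨p, _, hp⟩ := exists_absorber_of_cardwise g htri univ (by simp)
    have hmove : sahiE μ (n + 3) g = sahiE μ (n + 3) (Fin.cons (g p) (p.removeNth g) : Fin (n + 3) → α → ℝ) := by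
      conv_lhs => rw [← update_eq_self p g]
      exact SahiMeetTowerAll.sahiE_update_eq_sahiE_cons μ (n + 2) g p (g p)
    -- the tail `h = p.removeNth g` is triplewise meet-contained
    have htri' : ∀ S : Finset (Fin (n + 2)), S.card = 3 →
        ∃ q ∈ S, ∀ x, (1 - p.removeNth g q x) * ∏ i ∈ S.erase q, p.removeNth g i x = 0 :=
      triplewise_of_absorbs_three _ fun a b c _ _ _ =>
        absorbs_three_of_triplewise g h01 htri (p.succAbove a) (p.succAbove b) (p.succAbove c)
    obtain ⟨a, b, hab, hIH⟩ := ih (p.removeNth g) (fun i x => h01 _ x) (fun i => hmono _) htri'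
    refine ⟨p.succAbove a, p.succAbove b, fun h => hab (Fin.succAbove_right_injective h), ?_⟩
    -- Theorem E, quantitative: `E ≥ (n + 2 − E g_p)·E_{n+2}(h)`
    have hE : (((n + 1 : ℕ) : ℝ) + 1 - ex μ (g p)) * sahiE μ (n + 2) (p.removeNth g)
        ≤ sahiE μ (n + 3) (Fin.cons (g p) (p.removeNth g) : Fin (n + 3) → α → ℝ) := by
      refine sahiE_cons_ge_of_absorbs_top hμ.nonneg (n + 1) (g p) (p.removeNth g) (fun i x => hg0 _ x) (hg1 p) ?_ ?_
      · intro x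
        have key := hp x
        have e : (univ : Finset (Fin (n + 3))).erase p = univ.image p.succAbove := by
          rw [← Finset.compl_singleton, ← Fin.image_succAbove_univ]
        rw [e, Finset.prod_image (fun i _ j _ h => Fin.succAbove_right_injective h)] at key
        simpa only [Fin.removeNth] using key
      · intro T _ _
        exact sahiE_comp_nonneg_of_triplewise hμ (n + 3) g h01 hmono htri _ fun j => p.succAbove (Tᶜ.orderEmbOfFin rfl j)
    have hpos : 0 ≤ sahiE μ (n + 2) (p.removeNth g) :=
      sahiE_comp_nonneg_of_triplewise hμ (n + 3) g h01 hmono htri _ fun j => p.succAbove j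
    have hEd : ex μ (g p) ≤ 1 := by
      have := ex_mono (μ := μ) hμ.nonneg (hg1 p)
      rwa [ex_const hμ.sum_eq_one] at this
    have hcov : 0 ≤ ex μ (g (p.succAbove a) * g (p.succAbove b)) - ex μ (g (p.succAbove a)) * ex μ (g (p.succAbove b)) :=
      sub_nonneg.mpr (ex_mul_ex_le_ex_mul hμ (hg0 _) (hg0 _) (hmono _) (hmono _))
    rw [hmove]
    have hfac : (((n + 1)! : ℕ) : ℝ) = ((n : ℝ) + 1) * (n ! : ℝ) := by push_cast [Nat.factorial_succ]; ring
    rw [hfac]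
    have hIH' : (n ! : ℝ) * (ex μ (g (p.succAbove a) * g (p.succAbove b)) - ex μ (g (p.succAbove a)) * ex μ (g (p.succAbove b)))
        ≤ sahiE μ (n + 2) (p.removeNth g) := hIH
    have h1 : ((n : ℝ) + 1) * sahiE μ (n + 2) (p.removeNth g)
        ≤ (((n + 1 : ℕ) : ℝ) + 1 - ex μ (g p)) * sahiE μ (n + 2) (p.removeNth g) := by
      apply mul_le_mul_of_nonneg_right _ hpos
      push_cast
      linarith
    nlinarith [hIH', h1, hE, hcov, Nat.cast_nonneg (α := ℝ) (n !)]

end Quantitative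

end SahiHereditaryMeetAbsorption

end Summit.CriticalPhenomena.PercolationContinuityZ3.Theorems
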